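import Summits.MatrixMultiplication.MatrixMultiplication.Theorems.SoloInformedConverseDoorLimit
import Summits.MatrixMultiplication.MatrixMultiplication.Theorems.AsymptoticRankCWSkewPairRanges
import HarnessLib

/-!
# The converse door in the limit, for every carrier — and for the skew door tensor (`det₃`)

Solo seat `solo-MatrixMultiplication-informed`, §2o(6) of the sharpest statement; sequel to
`SoloInformedConverseDoorLimit` (the case `T_{cw,2}`, `T_{cw,2}^{⊠2} ≅ perm₃`).

Nothing in that file is special to `T_{cw,2}`: for ANY tensor `t` over any field,

* `asymptoticRank_le_of_asympLe` — `t ≲ s ⟹ R̃(t) ≤ R̃(s)` (asymptotic rank is monotone under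
  Zuiddam's asymptotic preorder; subsumes monotonicity under restriction and degeneration);
* `asymptoticRank_pow_le_of_asympLe` — `t^{⊠N} ≲ s ⟹ R̃(t)^N ≤ R̃(s)` (the universal spectral
  point attaining `R̃(t)` is multiplicative), in particular
  `asymptoticRank_pow_le_rpow_omega` — `t^{⊠N} ≲ ⟨q,q,q⟩ ⟹ R̃(t)^N ≤ q^ω`: every asymptotic
  embedding of Kronecker powers of a carrier into matrix multiplication is EXACTLY an upper bound
  `R̃(t) ≤ q^{ω/N}` (door D9 read backwards);
* `asympLe_sq_matMul_three` — `R̃(t) ≤ 3 ⟹ t ⊠ t ≲ ⟨3,3,3⟩`;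
* `sq_asympLe_matMul_three_iff` — given `ω = 2` and `3 ≤ R̃(t)`: `t ⊠ t ≲ ⟨3,3,3⟩ ↔ R̃(t) = 3`.

Specialised to the SKEW little Coppersmith–Winograd tensor `T_{skewcw,2}` (`skewCwTensor ℂ 1`;
`T_{skewcw,2}^{⊠2} ≅ det₃`, CGLV Lemma 2.10; `3 ≤ R̃(T_{skewcw,2}) ≤ √17` in the tree):
`converseDoor_limit_skew_iff` — **given `ω(ℂ) = 2`, `det₃ ≲ ⟨3,3,3⟩ ↔ R̃(T_{skewcw,2}) = 3`**, and
unconditionally `det₃ ≲ ⟨3,3,3⟩ ⟹ R̃(T_{skewcw,2}) ≤ 3^{ω/2}`.  So for BOTH tensors of CGLV §2.3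
("either `R̃(det₃) = 9` or `R̃(perm₃) = 9` would imply `ω = 2`") the converse direction through
matrix multiplication is circular.

References: V. Strassen, J. reine angew. Math. 384 (1988); J. Zuiddam, PhD thesis (2018), ch. 2;
A. Conner, F. Gesmundo, J. M. Landsberg, E. Ventura, arXiv:1909.04785, §2.3 and Lemma 2.10.
-/

noncomputable section

open scoped BigOperators

namespace Summit.MatrixMultiplication.MatrixMultiplication.Theorems.ConverseDoorLimit

open Literature.Computability.AlgebraicComplexity

variable {K : Type} [Field K]

section General

variable {ι κ μ ι' κ' μ' : Type} [Fintype ι] [Fintype κ] [Fintype μ] [Fintype ι'] [Fintype κ']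
  [Fintype μ']

/-- **`R̃` is monotone under asymptotic restriction**: `t ≲ s ⟹ R̃(t) ≤ R̃(s)`. -/
theorem asymptoticRank_le_of_asympLe {t : ι → κ → μ → K} {s : ι' → κ' → μ' → K}
    (h : AsympLe (fun x y : TensorClass K => x ≤ y) (TensorClass.mk t) (TensorClass.mk s)) :
    asymptoticRank t ≤ asymptoticRank s := by
  obtain ⟨F, hF, hFt⟩ := (strassen_duality_asymptoticRank_holds K t).2
  rw [← hFt]
  exact ((asympLe_iff_spectral.1 h) F hF).trans ((strassen_duality_asymptoticRank_holds K s).1 F hF)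

/-- **`t^{⊠N} ≲ s ⟹ R̃(t)^N ≤ R̃(s)`**: the universal spectral point attaining `R̃(t)` (Strassen
duality) is multiplicative on Kronecker powers. -/
theorem asymptoticRank_pow_le_of_asympLe {t : ι → κ → μ → K} {s : ι' → κ' → μ' → K} (N : ℕ)
    (h : AsympLe (fun x y : TensorClass K => x ≤ y) (TensorClass.mk (kroneckerPow t N))
      (TensorClass.mk s)) :
    asymptoticRank t ^ N ≤ asymptoticRank s := by
  obtain ⟨F, hF, hFt⟩ := (strassen_duality_asymptoticRank_holds K t).2
  rw [← hFt, ← hF.map_kroneckerPow]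
  exact ((asympLe_iff_spectral.1 h) F hF).trans ((strassen_duality_asymptoticRank_holds K s).1 F hF)

/-- **Door D9 read backwards, for every carrier**: `t^{⊠N} ≲ ⟨q,q,q⟩ ⟹ R̃(t)^N ≤ q^ω`
(`q ≥ 1`). -/
theorem asymptoticRank_pow_le_rpow_omega {t : ι → κ → μ → K} {q : ℕ} (hq : 1 ≤ q) (N : ℕ)
    (h : AsympLe (fun x y : TensorClass K => x ≤ y) (TensorClass.mk (kroneckerPow t N))
      (TensorClass.mk (matMulTensor K q q q))) :
    asymptoticRank t ^ N ≤ (q : ℝ) ^ omega K := by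
  rw [← asymptoticRank_matMulTensor K q hq]
  exact asymptoticRank_pow_le_of_asympLe N h

/-- `t ⊠ t ≲ ⟨3,3,3⟩ ⟹ R̃(t)² ≤ 3^ω`. -/
theorem asymptoticRank_sq_le_of_sq_asympLe_matMul_three {t : ι → κ → μ → K}
    (h : AsympLe (fun x y : TensorClass K => x ≤ y) (TensorClass.mk (kroneckerTensor t t))
      (TensorClass.mk (matMulTensor K 3 3 3))) :
    asymptoticRank t ^ 2 ≤ (3 : ℝ) ^ omega K := by
  obtain ⟨F, hF, hFt⟩ := (strassen_duality_asymptoticRank_holds K t).2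
  have h1 := (asympLe_iff_spectral.1 h) F hF
  rw [hF.map_kronecker, hFt] at h1
  have h2 := (strassen_duality_asymptoticRank_holds K (matMulTensor K 3 3 3)).1 F hF
  rw [asymptoticRank_matMulTensor K 3 (by norm_num)] at h2
  push_cast at h2
  rw [sq]
  exact h1.trans h2

/-- Hence `t ⊠ t ≲ ⟨3,3,3⟩ ⟹ R̃(t) ≤ 3^{ω/2}`. -/
theorem asymptoticRank_le_rpow_of_sq_asympLe_matMul_three {t : ι → κ → μ → K}
    (h : AsympLe (fun x y : TensorClass K => x ≤ y) (TensorClass.mk (kroneckerTensor t t))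
      (TensorClass.mk (matMulTensor K 3 3 3))) :
    asymptoticRank t ≤ (3 : ℝ) ^ (omega K / 2) := by
  have h2 := asymptoticRank_sq_le_of_sq_asympLe_matMul_three h
  have h0 : 0 ≤ asymptoticRank t := asymptoticRank_nonneg _
  calc asymptoticRank t
      = (asymptoticRank t ^ 2) ^ ((2 : ℕ) : ℝ)⁻¹ :=
        (Real.pow_rpow_inv_natCast h0 two_ne_zero).symm
    _ ≤ ((3 : ℝ) ^ omega K) ^ ((2 : ℕ) : ℝ)⁻¹ :=
        Real.rpow_le_rpow (pow_nonneg h0 2) h2 (by positivity)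
    _ = (3 : ℝ) ^ (omega K / 2) := by
        rw [← Real.rpow_mul (by norm_num : (0 : ℝ) ≤ 3)]
        norm_num [div_eq_mul_inv]

/-- **`R̃(t) ≤ 3 ⟹ t ⊠ t ≲ ⟨3,3,3⟩`**, for every tensor `t` over every field:
`F(t)² ≤ 9 ≤ F(⟨3,3,3⟩)` for every universal spectral point. -/
theorem asympLe_sq_matMul_three {t : ι → κ → μ → K} (h : asymptoticRank t ≤ 3) :
    AsympLe (fun x y : TensorClass K => x ≤ y) (TensorClass.mk (kroneckerTensor t t))
      (TensorClass.mk (matMulTensor K 3 3 3)) := by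
  refine asympLe_iff_spectral.2 fun F hF => ?_
  rw [hF.map_kronecker]
  have h1 : F t ≤ 3 := ((strassen_duality_asymptoticRank_holds K _).1 F hF).trans h
  have h0 : 0 ≤ F t := hF.nonneg _
  have h9 : (9 : ℝ) ≤ F (matMulTensor K 3 3 3) := by
    have := sq_le_spectral_matMul hF (n := 3) (by norm_num)
    norm_num at this
    exact this
  nlinarith

/-- **Given `ω = 2` and `3 ≤ R̃(t)`: `t ⊠ t ≲ ⟨3,3,3⟩ ↔ R̃(t) = 3.** -/
theorem sq_asympLe_matMul_three_iff (hω : omega K = 2) {t : ι → κ → μ → K}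
    (h3 : 3 ≤ asymptoticRank t) :
    AsympLe (fun x y : TensorClass K => x ≤ y) (TensorClass.mk (kroneckerTensor t t))
        (TensorClass.mk (matMulTensor K 3 3 3)) ↔ asymptoticRank t = 3 := by
  constructor
  · intro h
    have h1 := asymptoticRank_sq_le_of_sq_asympLe_matMul_three h
    rw [hω] at h1
    norm_num at h1
    nlinarith
  · intro h
    exact asympLe_sq_matMul_three h.le

end General

/-! ## The skew door tensor: `det₃ ≅ T_{skewcw,2} ⊠ T_{skewcw,2}` -/

section Skew

/-- `det₃ ≲ ⟨3,3,3⟩ ⟹ R̃(T_{skewcw,2}) ≤ 3^{ω/2}` (over `ℂ`; unconditional). -/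
theorem asymptoticRank_skewCwTwo_le_rpow
    (h : AsympLe (fun x y : TensorClass ℂ => x ≤ y)
      (TensorClass.mk (kroneckerTensor (skewCwTensor ℂ 1) (skewCwTensor ℂ 1)))
      (TensorClass.mk (matMulTensor ℂ 3 3 3))) :
    asymptoticRank (skewCwTensor ℂ 1) ≤ (3 : ℝ) ^ (omega ℂ / 2) :=
  asymptoticRank_le_rpow_of_sq_asympLe_matMul_three h

/-- **THE CONVERSE SKEW DOOR IN THE LIMIT IS THE SKEW DOOR.** Given `ω(ℂ) = 2`:
`det₃ ≅ T_{skewcw,2} ⊠ T_{skewcw,2} ≲ ⟨3,3,3⟩ ↔ R̃(T_{skewcw,2}) = 3`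
(`3 ≤ R̃(T_{skewcw,2})` is `asymptoticRank_skewCwTensor_one_mem_Icc`). -/
theorem converseDoor_limit_skew_iff (hω : omega ℂ = 2) :
    AsympLe (fun x y : TensorClass ℂ => x ≤ y)
        (TensorClass.mk (kroneckerTensor (skewCwTensor ℂ 1) (skewCwTensor ℂ 1)))
        (TensorClass.mk (matMulTensor ℂ 3 3 3)) ↔
      asymptoticRank (skewCwTensor ℂ 1) = 3 :=
  sq_asympLe_matMul_three_iff hω asymptoticRank_skewCwTensor_one_mem_Icc.1

/-- The same with the summit constant as hypothesis. -/
theorem converseDoor_limit_skew_iff_of_summit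
    (hω : Literature.Computability.AlgebraicComplexity.MatrixMultiplication) :
    AsympLe (fun x y : TensorClass ℂ => x ≤ y)
        (TensorClass.mk (kroneckerTensor (skewCwTensor ℂ 1) (skewCwTensor ℂ 1)))
        (TensorClass.mk (matMulTensor ℂ 3 3 3)) ↔
      asymptoticRank (skewCwTensor ℂ 1) = 3 :=
  converseDoor_limit_skew_iff hω

/-- Under `ω(ℂ) = 2` the two doors of CGLV §2.3 are the two embeddings: `perm₃ ≲ ⟨3,3,3⟩ ↔
R̃(T_{cw,2}) = 3` and `det₃ ≲ ⟨3,3,3⟩ ↔ R̃(T_{skewcw,2}) = 3`. -/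
theorem converseDoors_limit_of_summit
    (hω : Literature.Computability.AlgebraicComplexity.MatrixMultiplication) :
    (AsympLe (fun x y : TensorClass ℂ => x ≤ y)
        (TensorClass.mk (kroneckerTensor (cwTensor ℂ 2) (cwTensor ℂ 2)))
        (TensorClass.mk (matMulTensor ℂ 3 3 3)) ↔ asymptoticRank (cwTensor ℂ 2) = 3) ∧
    (AsympLe (fun x y : TensorClass ℂ => x ≤ y)
        (TensorClass.mk (kroneckerTensor (skewCwTensor ℂ 1) (skewCwTensor ℂ 1)))
        (TensorClass.mk (matMulTensor ℂ 3 3 3)) ↔ asymptoticRank (skewCwTensor ℂ 1) = 3) :=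
  ⟨converseDoor_limit_iff hω, converseDoor_limit_skew_iff hω⟩

end Skew

end Summit.MatrixMultiplication.MatrixMultiplication.Theorems.ConverseDoorLimit

end
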